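import Summits.AtomisticToContinuum.HydrodynamicLimit.Theorems.EnskogAdjointDualityDualityReductionPathwise
import Summits.AtomisticToContinuum.HydrodynamicLimit.Theorems.EnskogAdjointDualityDualityReductionMoments
import Literature.MathematicalPhysics.KineticTheory.EvenStatTruncationBound
import HarnessLib

/-!
# EnskogAdjointDuality / DualityReduction — helper 10: the `L²` assembly of the duality argument

Support lemmas for `Summit.AtomisticToContinuum.HydrodynamicLimit.Theses.EnskogAdjointDuality.DualityReduction`
(stmt-AtomisticToContinuum-11590). Integrating the square of the pathwise estimate of helper 9
against the local Gibbs law and letting `N → ∞`: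

`∫ (A_t − B_t)² dP_N ≤ 5 [∫ (A_0−B_0)² + (η_N t)² ∫(1+e)² + (I₃+½I₂)² + Res_N² + ∫ R_N²] → 0`,

the five terms being controlled by the `t = 0` hypothesis, the conserved-energy moment bound
(helper 2), the Euler-side bound (helper 8), the Enskog defect `Res_N → 0` (crux
`AdjointEnskogTestFamilyR` (v)) and the collision residual `∫R_N² → 0` (crux
`CollisionResidualVanishes`). Everything specific to the route enters as a hypothesis in the
literal shape of the route file; the output is the mean-square convergence of
`A_t = ⟨μ^N_t, φ^N_t⟩` to `B_t = ∫∫ f_t φ^N_t`.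

* `duality_assembly` — the statement above.

References: M. Pulvirenti, S. Simonella, arXiv:1504.03215 [PulvirentiSimonella2016];
T. Bodineau, I. Gallagher, L. Saint-Raymond, Ann. PDE 3 (2017) (L² duality method) [BGSR2017].
-/

noncomputable section

open MeasureTheory Set Filter Topology Function
open scoped ENNReal BigOperators InnerProductSpace

namespace Summit.AtomisticToContinuum.HydrodynamicLimit.Theorems

open Literature.Analysis.FluidPDE Literature.MathematicalPhysics.KineticTheory

/-- `(a + b + c + d + e)² ≤ 5 (a² + b² + c² + d² + e²)`. [folklore] -/
private theorem sq_add_five_le (a b c d e : ℝ) :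
    (a + b + c + d + e) ^ 2 ≤ 5 * (a ^ 2 + b ^ 2 + c ^ 2 + d ^ 2 + e ^ 2) := by
  nlinarith [sq_nonneg (a - b), sq_nonneg (a - c), sq_nonneg (a - d), sq_nonneg (a - e),
    sq_nonneg (b - c), sq_nonneg (b - d), sq_nonneg (b - e), sq_nonneg (c - d), sq_nonneg (c - e),
    sq_nonneg (d - e)]

/-- Real sequences tending to `0` have `ENNReal.ofReal` of their squares tending to `0`.
[folklore] -/
private theorem tendsto_ofReal_sq_of_tendsto_zero {g : ℕ → ℝ} (hg : Tendsto g atTop (𝓝 0)) :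
    Tendsto (fun N => ENNReal.ofReal (g N ^ 2)) atTop (𝓝 0) := by
  have h : Tendsto (fun N => g N ^ 2) atTop (𝓝 0) := by simpa using hg.pow 2
  simpa using ENNReal.tendsto_ofReal h

variable {a₀ θ₀ : T3 → ℝ} {u₀ : T3 → V3}

/-- **The `L²` assembly of the duality argument.** See the module docstring: given, for a
family of test functions `φ^N` (continuous), kernels `L^N` (growth `(1+|v|²)²` on `[0, t]`,
measurable after freezing time) and the Euler local Maxwellian weight `f`, (a) `C¹`-regularity along
free flight and the defect bound `|Dφ^N + L^Nφ^N| ≤ η_N(1+|v|²)` on `[0, t]` eventually, `η_N → 0`;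
(b) the collision residual `R_N` (in the route's literal form) with `∫ R_N² dP_N → 0`; (c) the
Enskog defect of `f` tested on the family `→ 0`; (d) the Euler-side combination
`I₃ + ½I₂ → 0`; (e) the `t = 0` term `→ 0` in `L²(P_N)` — then `⟨μ^N_t, φ^N_t⟩ − ∫∫ f_t φ^N_t → 0`
in `L²(P_N)` under the local Gibbs laws (`σ ≤ 1/2`). [cite: PulvirentiSimonella2016, §2] -/
theorem duality_assembly (ha : Continuous a₀) (hθ : Continuous θ₀) (hu : Continuous u₀)
    (ha0 : ∀ x, 0 < a₀ x) (hθ0 : ∀ x, 0 < θ₀ x) {σ : ℝ} (hσ : σ ≤ 1 / 2)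
    (Φ : (N : ℕ) → HardSphereFlow (Torus.geometry (Fin 3)) (hsDiameter σ N) (N + 1))
    {t : ℝ} (ht : 0 < t)
    (φ L : ℕ → ℝ → T3 → V3 → ℝ) (f : ℝ → T3 → V3 → ℝ)
    (Rres : (N : ℕ) → Config (N + 1) (Fin 3) T3 → ℝ)
    (hφc : ∀ N, Continuous fun p : ℝ × T3 × V3 => φ N p.1 p.2.1 p.2.2)
    (hreg : ∃ η : ℕ → ℝ, Tendsto η atTop (𝓝 0) ∧ ∀ᶠ N in atTop,
      (∀ x v, ContDiffOn ℝ 1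
        (fun r => φ N r ((Torus.geometry (Fin 3)).translate x (r • v)) v) (Icc 0 t)) ∧
      (∀ s ∈ Icc 0 t, ∀ x v,
        |derivWithin (fun r => φ N r ((Torus.geometry (Fin 3)).translate x ((r - s) • v)) v)
            (Icc 0 t) s + L N s x v| ≤ η N * (1 + ‖v‖ ^ 2)))
    (hL : ∀ N, ∃ K : ℝ, (∀ s ∈ Icc 0 t, ∀ x v, |L N s x v| ≤ K * (1 + ‖v‖ ^ 2) ^ 2) ∧
      Measurable fun p : ℝ × T3 × V3 => L N (max 0 (min t p.1)) p.2.1 p.2.2)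
    (hR : ∀ N z, Rres N z = ((N : ℝ) + 1)⁻¹ *
        (∑ᶠ (s : ℝ) (_ : s ∈ collisionTimes (Torus.geometry (Fin 3)) (hsDiameter σ N)
            (fun r => (Φ N).flow r z) ∩ Ioc 0 t),
          ∑ i : Fin (N + 1), ∑ j : Fin (N + 1),
            (if i ≠ j ∧ ‖(Torus.geometry (Fin 3)).sepVec ((Φ N).flow s z i).1 ((Φ N).flow s z j).1‖ =
                hsDiameter σ N then
              φ N s ((Φ N).flow s z i).1 ((Φ N).flow s z i).2 -
                φ N s ((Φ N).flow s z i).1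
                  (reflectVel ((Torus.geometry (Fin 3)).sepVec ((Φ N).flow s z i).1 ((Φ N).flow s z j).1)
                    (((Φ N).flow s z i).2, ((Φ N).flow s z j).2)).1
            else 0)) -
        (∫ s in Icc 0 t, ∫ y, L N s y.1 y.2 ∂(empiricalMeasure ((Φ N).flow s z))) +
        (1 / 2 : ℝ) * ∫ s in Icc 0 t, ∫ x, ∫ v, f s x v * L N s x v)
    (hK1 : Tendsto (fun N => ∫⁻ z, ENNReal.ofReal (Rres N z ^ 2)
      ∂localGibbsLaw σ a₀ u₀ θ₀ N (Φ N)) atTop (𝓝 0))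
    (hRes : Tendsto (fun N => (∫ x, ∫ v, f t x v * φ N t x v) - (∫ x, ∫ v, f 0 x v * φ N 0 x v) -
      ∫ s in Icc 0 t, ∫ x, ∫ v, f s x v *
        (derivWithin (fun r => φ N r ((Torus.geometry (Fin 3)).translate x ((r - s) • v)) v)
          (Icc 0 t) s + (1 / 2 : ℝ) * L N s x v)) atTop (𝓝 0))
    (hF : Tendsto (fun N => (∫ s in Icc 0 t, ∫ x, ∫ v, f s x v *
        (derivWithin (fun r => φ N r ((Torus.geometry (Fin 3)).translate x ((r - s) • v)) v)
          (Icc 0 t) s + (1 / 2 : ℝ) * L N s x v)) +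
      (1 / 2 : ℝ) * ∫ s in Icc 0 t, ∫ x, ∫ v, f s x v * L N s x v) atTop (𝓝 0))
    (h0 : Tendsto (fun N => ∫⁻ z, ENNReal.ofReal
      ((((N : ℝ) + 1)⁻¹ * (∑ i, φ N 0 (z i).1 (z i).2) - ∫ x, ∫ v, f 0 x v * φ N 0 x v) ^ 2)
      ∂localGibbsLaw σ a₀ u₀ θ₀ N (Φ N)) atTop (𝓝 0)) :
    Tendsto (fun N => ∫⁻ z, ENNReal.ofReal
      ((((N : ℝ) + 1)⁻¹ * (∑ i, φ N t ((Φ N).flow t z i).1 ((Φ N).flow t z i).2) -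
        ∫ x, ∫ v, f t x v * φ N t x v) ^ 2)
      ∂localGibbsLaw σ a₀ u₀ θ₀ N (Φ N)) atTop (𝓝 0) := by
  obtain ⟨η, hη, hev⟩ := hreg
  haveI hP : ∀ N, IsProbabilityMeasure (localGibbsLaw σ a₀ u₀ θ₀ N (Φ N)) := fun N =>
    isProbabilityMeasure_localGibbsLaw ha hθ hu ha0 hθ0 hσ N (Φ N)
  -- the conserved-energy moment bound, flow-free
  obtain ⟨Cm, hCm0, hCm⟩ := lintegral_one_add_energy_pow_four_flow_le ha hθ hu ha0 hθ0 hσ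
  have hmom : ∀ N, ∫⁻ z, ENNReal.ofReal ((1 + ((N + 1 : ℕ) : ℝ)⁻¹ * ∑ i, ‖(z i).2‖ ^ 2) ^ 2)
      ∂localGibbsLaw σ a₀ u₀ θ₀ N (Φ N) ≤ ENNReal.ofReal Cm := by
    intro N
    have hgood : ∀ᵐ z ∂localGibbsLaw σ a₀ u₀ θ₀ N (Φ N), z ∈ (Φ N).good :=
      mem_ae_iff.2 (localGibbsLaw_compl_good_eq_zero (Φ N))
    calc ∫⁻ z, ENNReal.ofReal ((1 + ((N + 1 : ℕ) : ℝ)⁻¹ * ∑ i, ‖(z i).2‖ ^ 2) ^ 2)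
          ∂localGibbsLaw σ a₀ u₀ θ₀ N (Φ N)
        = ∫⁻ z, ENNReal.ofReal ((1 + ((N + 1 : ℕ) : ℝ)⁻¹ * ∑ i, ‖((Φ N).flow 0 z i).2‖ ^ 2) ^ 2)
          ∂localGibbsLaw σ a₀ u₀ θ₀ N (Φ N) := by
          refine lintegral_congr_ae ?_
          filter_upwards [hgood] with z hz
          rw [(Φ N).flow_zero z hz]
      _ ≤ ENNReal.ofReal Cm := hCm N (Φ N) 0 2 (by norm_num)
  -- names for the scalar sequences
  set fs : ℕ → ℝ := fun N => (∫ s in Icc 0 t, ∫ x, ∫ v, f s x v *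
      (derivWithin (fun r => φ N r ((Torus.geometry (Fin 3)).translate x ((r - s) • v)) v)
        (Icc 0 t) s + (1 / 2 : ℝ) * L N s x v)) +
    (1 / 2 : ℝ) * ∫ s in Icc 0 t, ∫ x, ∫ v, f s x v * L N s x v with hfs
  set res : ℕ → ℝ := fun N => (∫ x, ∫ v, f t x v * φ N t x v) - (∫ x, ∫ v, f 0 x v * φ N 0 x v) -
      ∫ s in Icc 0 t, ∫ x, ∫ v, f s x v *
        (derivWithin (fun r => φ N r ((Torus.geometry (Fin 3)).translate x ((r - s) • v)) v)
          (Icc 0 t) s + (1 / 2 : ℝ) * L N s x v) with hres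
  -- the dominating sequence
  set G : ℕ → ℝ≥0∞ := fun N => ENNReal.ofReal 5 *
    ((∫⁻ z, ENNReal.ofReal ((((N : ℝ) + 1)⁻¹ * (∑ i, φ N 0 (z i).1 (z i).2) -
        ∫ x, ∫ v, f 0 x v * φ N 0 x v) ^ 2) ∂localGibbsLaw σ a₀ u₀ θ₀ N (Φ N)) +
      (ENNReal.ofReal ((η N * t) ^ 2) * ENNReal.ofReal Cm +
      (ENNReal.ofReal (fs N ^ 2) +
      (ENNReal.ofReal (res N ^ 2) +
      ∫⁻ z, ENNReal.ofReal (Rres N z ^ 2) ∂localGibbsLaw σ a₀ u₀ θ₀ N (Φ N))))) with hG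
  have hGlim : Tendsto G atTop (𝓝 0) := by
    have h2 : Tendsto (fun N => ENNReal.ofReal ((η N * t) ^ 2) * ENNReal.ofReal Cm) atTop (𝓝 0) := by
      have := ENNReal.Tendsto.mul_const (tendsto_ofReal_sq_of_tendsto_zero (by simpa using hη.mul_const t))
        (Or.inr ENNReal.ofReal_ne_top : (0 : ℝ≥0∞) ≠ 0 ∨ ENNReal.ofReal Cm ≠ ⊤)
      simpa using this
    have h3 : Tendsto (fun N => ENNReal.ofReal (fs N ^ 2)) atTop (𝓝 0) :=
      tendsto_ofReal_sq_of_tendsto_zero hF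
    have h4 : Tendsto (fun N => ENNReal.ofReal (res N ^ 2)) atTop (𝓝 0) :=
      tendsto_ofReal_sq_of_tendsto_zero hRes
    have hsum := h0.add (h2.add (h3.add (h4.add hK1)))
    simp only [add_zero] at hsum
    have := ENNReal.Tendsto.const_mul hsum (Or.inr ENNReal.ofReal_ne_top :
      (0 : ℝ≥0∞) ≠ 0 ∨ ENNReal.ofReal 5 ≠ ⊤)
    simpa [hG] using this
  -- eventually the pathwise estimate applies
  refine tendsto_of_tendsto_of_tendsto_of_le_of_le' tendsto_const_nhds hGlim
    (Eventually.of_forall fun N => bot_le) ?_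
  filter_upwards [hev] with N hN
  obtain ⟨hC1, hdef⟩ := hN
  obtain ⟨K, hKb, hKm⟩ := hL N
  have hη0 : 0 ≤ η N := by
    have h := (abs_nonneg _).trans (hdef 0 ⟨le_rfl, ht.le⟩ 0 0)
    simpa using h
  set n : ℝ := (N : ℝ) + 1 with hn
  set B0 : ℝ := ∫ x, ∫ v, f 0 x v * φ N 0 x v with hB0
  set Bt : ℝ := ∫ x, ∫ v, f t x v * φ N t x v with hBt
  set X0 : Config (N + 1) (Fin 3) T3 → ℝ := fun z =>
    n⁻¹ * (∑ i, φ N 0 (z i).1 (z i).2) - B0 with hX0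
  set en : Config (N + 1) (Fin 3) T3 → ℝ := fun z =>
    ((N + 1 : ℕ) : ℝ)⁻¹ * ∑ i, ‖(z i).2‖ ^ 2 with hen
  -- pointwise a.e. bound
  have hgood : ∀ᵐ z ∂localGibbsLaw σ a₀ u₀ θ₀ N (Φ N), z ∈ (Φ N).good :=
    mem_ae_iff.2 (localGibbsLaw_compl_good_eq_zero (Φ N))
  have hpt : ∀ᵐ z ∂localGibbsLaw σ a₀ u₀ θ₀ N (Φ N),
      ENNReal.ofReal ((n⁻¹ * (∑ i, φ N t ((Φ N).flow t z i).1 ((Φ N).flow t z i).2) - Bt) ^ 2) ≤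
        ENNReal.ofReal 5 * (ENNReal.ofReal (X0 z ^ 2) +
          (ENNReal.ofReal ((η N * t) ^ 2) * ENNReal.ofReal ((1 + en z) ^ 2) +
          (ENNReal.ofReal (fs N ^ 2) + (ENNReal.ofReal (res N ^ 2) +
            ENNReal.ofReal (Rres N z ^ 2))))) := by
    filter_upwards [hgood] with z hz
    have hLint := integrableOn_enskogL_orbit (Φ N) hz (L N) hKb hKm
    have hpw := pathwise_duality_bound (Φ N) hz ht (φ N) (L N) hC1 hdef hLint
      (Rz := Rres N z) (Res := res N) (I₂ := ∫ s in Icc 0 t, ∫ x, ∫ v, f s x v * L N s x v)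
      (I₃ := ∫ s in Icc 0 t, ∫ x, ∫ v, f s x v *
        (derivWithin (fun r => φ N r ((Torus.geometry (Fin 3)).translate x ((r - s) • v)) v)
          (Icc 0 t) s + (1 / 2 : ℝ) * L N s x v)) (Bt := Bt) (B0 := B0) (hR N z)
      (by simp only [hres, hBt, hB0])
    have hen0 : 0 ≤ en z := by positivity
    have hsq : (n⁻¹ * (∑ i, φ N t ((Φ N).flow t z i).1 ((Φ N).flow t z i).2) - Bt) ^ 2 ≤
        5 * (X0 z ^ 2 + (η N * t) ^ 2 * (1 + en z) ^ 2 + fs N ^ 2 + res N ^ 2 + Rres N z ^ 2) := by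
      have h1 : |n⁻¹ * (∑ i, φ N t ((Φ N).flow t z i).1 ((Φ N).flow t z i).2) - Bt| ≤
          |X0 z| + η N * t * (1 + en z) + |fs N| + |Rres N z| + |res N| := by
        simpa only [hX0, hen, hfs] using hpw
      have hnn : 0 ≤ |X0 z| + η N * t * (1 + en z) + |fs N| + |Rres N z| + |res N| := by positivity
      calc (n⁻¹ * (∑ i, φ N t ((Φ N).flow t z i).1 ((Φ N).flow t z i).2) - Bt) ^ 2
          = |n⁻¹ * (∑ i, φ N t ((Φ N).flow t z i).1 ((Φ N).flow t z i).2) - Bt| ^ 2 := (sq_abs _).symm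
        _ ≤ (|X0 z| + η N * t * (1 + en z) + |fs N| + |Rres N z| + |res N|) ^ 2 :=
            pow_le_pow_left₀ (abs_nonneg _) h1 2
        _ ≤ 5 * (|X0 z| ^ 2 + (η N * t * (1 + en z)) ^ 2 + |fs N| ^ 2 + |Rres N z| ^ 2 + |res N| ^ 2) :=
            sq_add_five_le _ _ _ _ _
        _ = 5 * (X0 z ^ 2 + (η N * t) ^ 2 * (1 + en z) ^ 2 + fs N ^ 2 + res N ^ 2 + Rres N z ^ 2) := by
            simp only [sq_abs]; ring
    calc ENNReal.ofReal ((n⁻¹ * (∑ i, φ N t ((Φ N).flow t z i).1 ((Φ N).flow t z i).2) - Bt) ^ 2)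
        ≤ ENNReal.ofReal (5 * (X0 z ^ 2 + (η N * t) ^ 2 * (1 + en z) ^ 2 + fs N ^ 2 + res N ^ 2 +
            Rres N z ^ 2)) := ENNReal.ofReal_le_ofReal hsq
      _ = _ := by
          rw [ENNReal.ofReal_mul (by norm_num), ENNReal.ofReal_add (by positivity) (by positivity),
            ENNReal.ofReal_add (by positivity) (by positivity),
            ENNReal.ofReal_add (by positivity) (by positivity),
            ENNReal.ofReal_add (by positivity) (by positivity), ENNReal.ofReal_mul (by positivity)]
          ring
  -- measurability of the summands that need it
  have hX0m : Measurable fun z => ENNReal.ofReal (X0 z ^ 2) := by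
    have hm : Measurable X0 := by
      refine (Measurable.const_mul ?_ _).sub measurable_const
      refine Finset.measurable_sum _ fun i _ => ?_
      exact (hφc N).measurable.comp (measurable_const.prodMk
        ((measurable_pi_apply i).fst.prodMk (measurable_pi_apply i).snd))
    exact (hm.pow_const 2).ennreal_ofReal
  have henm : Measurable fun z => ENNReal.ofReal ((η N * t) ^ 2) * ENNReal.ofReal ((1 + en z) ^ 2) := by
    refine Measurable.const_mul ?_ _
    refine ((measurable_const.add (Measurable.const_mul ?_ _)).pow_const 2).ennreal_ofReal
    exact Finset.measurable_sum _ fun i _ => ((measurable_pi_apply i).snd.norm).pow_const 2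
  -- integrate
  calc ∫⁻ z, ENNReal.ofReal ((n⁻¹ * (∑ i, φ N t ((Φ N).flow t z i).1 ((Φ N).flow t z i).2) - Bt) ^ 2)
        ∂localGibbsLaw σ a₀ u₀ θ₀ N (Φ N)
      ≤ ∫⁻ z, ENNReal.ofReal 5 * (ENNReal.ofReal (X0 z ^ 2) +
          (ENNReal.ofReal ((η N * t) ^ 2) * ENNReal.ofReal ((1 + en z) ^ 2) +
          (ENNReal.ofReal (fs N ^ 2) + (ENNReal.ofReal (res N ^ 2) +
            ENNReal.ofReal (Rres N z ^ 2))))) ∂localGibbsLaw σ a₀ u₀ θ₀ N (Φ N) :=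
        lintegral_mono_ae hpt
    _ = ENNReal.ofReal 5 * ((∫⁻ z, ENNReal.ofReal (X0 z ^ 2) ∂localGibbsLaw σ a₀ u₀ θ₀ N (Φ N)) +
          (ENNReal.ofReal ((η N * t) ^ 2) *
              ∫⁻ z, ENNReal.ofReal ((1 + en z) ^ 2) ∂localGibbsLaw σ a₀ u₀ θ₀ N (Φ N) +
          (ENNReal.ofReal (fs N ^ 2) + (ENNReal.ofReal (res N ^ 2) +
            ∫⁻ z, ENNReal.ofReal (Rres N z ^ 2) ∂localGibbsLaw σ a₀ u₀ θ₀ N (Φ N))))) := by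
        rw [lintegral_const_mul' _ _ ENNReal.ofReal_ne_top, lintegral_add_left hX0m,
          lintegral_add_left henm, lintegral_const_mul' _ _ ENNReal.ofReal_ne_top,
          lintegral_add_left measurable_const, lintegral_add_left measurable_const,
          lintegral_const, lintegral_const, measure_univ, mul_one, mul_one]
    _ ≤ G N := by
        simp only [hG]
        gcongr
        exact hmom N

end Summit.AtomisticToContinuum.HydrodynamicLimit.Theorems

end
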